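import Literature.Computability.Complexity.FKPointLocationCodes
import Literature.Computability.Complexity.FKPointLocationCertificatesBelow
import HarnessLib

/-!
# Fournier–Koiran point location, VI: the location protocol (definitions)

Topic `Literature/Computability/Complexity`, grouping namespace `FKPointLocation`. The point-location
procedure of Fournier–Koiran (ICALP 2000 = LIP RR-1999-21, §2: Meyer auf der Heide's construction
made uniform with an NP oracle) as an explicit INTERACTIVE PROTOCOL with two kinds of one-bit
queries — SIGN queries (an integer affine form, answered by the sign of its value at the input
`x̂ ∈ ℝ^D`) and NP queries (answered by the truth of an existential arithmetic statement about the
protocol's own state) — in the shape the oracle machine of `FKPointLocationMachine*.lean` runs it: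

* `Task` — the OBLIVIOUS SCHEDULE: the sequence of queries does not depend on the answers, only
  their contents do; `levelTasks`, `agenda` (levels `0, …, D`, then the final query);
* `LevelRec`, `Scratch`, `Data` — the state; `Data.init`;
* `localForm`/`queryForm` — the form of a sign task (binary search `bsForm`, equality tests
  `geForm`/`leForm`, facet comparison `faForm`), lifted through the apexes of the completed levels
  (`liftAll`, `FKPointLocationSearch.lean`); `npTruth` — the statement of an NP task (chain slot
  existence / prefix bit, stability, apex prefix bit, final question `finT`); `truth`;
* `upd` — the state transition on one answer bit; `step`, `runFrom`, `finalData`;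
* `certOf` — the location certificate (`FKPointLocationCertificates.Cert`) read off the state.

Correctness (`certOf (finalData …)` is `Valid`, and the output bit is `finT` of it) is proved in
`FKPointLocationProtocolValid.lean`.

## References

* H. Fournier, P. Koiran, *Lower bounds are not easier over the reals: inside PH*, ICALP 2000,
  LNCS 1853 = LIP RR-1999-21, §2.1 (Steps 1 and k: binary search, `H_n^k`, chain `E_i` by prefix
  search, apex `s_n^k`, test `x = s_n^k`, choice of the face), §2.3 (homogenisation: level `0` with
  apex `0`), Thm 2. [FournierKoiran2000]
-/

namespace Literature.Computability.Complexity

namespace FKPointLocation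

open Finset

/-! ### Tasks and the schedule -/

/-- The tasks (one query each) of the protocol in dimension `D`. [cite: FournierKoiran2000, §2.1] -/
inductive Task (D : ℕ) : Type
  /-- binary search of coordinate `i`, round `k` -/
  | bs (i : Fin D) (k : ℕ)
  /-- chain slot `m` of scale `sc`: is there a valid triple? -/
  | ex (sc m : ℕ)
  /-- chain slot `m` of scale `sc`: prefix bit `w` of the form -/
  | pf (sc m w : ℕ)
  /-- is scale `sc` unstable? -/
  | st (sc : ℕ)
  /-- prefix bit `w` of the apex -/
  | ap (w : ℕ)
  /-- equality test `x_i - s_i ≥ 0`? -/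
  | eqGe (i : Fin D)
  /-- equality test `s_i - x_i ≥ 0`? -/
  | eqLe (i : Fin D)
  /-- facet comparison of the current candidate with `i` -/
  | fa (i : Fin D)
  /-- closing the level (idle query) -/
  | close
  /-- the final NP query -/
  | fin
  deriving DecidableEq

namespace Task

variable {D : ℕ}

/-- Sign tasks (answered by the sign oracle); the others are NP tasks. [folklore] -/
def isSign : Task D → Bool
  | bs _ _ => true
  | eqGe _ => true
  | eqLe _ => true
  | fa _ => true
  | close => true
  | _ => false

end Task

variable (Q : LevelParams)

/-- The tasks of level `j` (level `0` has no search phases: its apex is the origin).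
[cite: FournierKoiran2000, §2.1 Steps 1 and k, §2.3] -/
def levelTasks (j : ℕ) : List (Task Q.D) :=
  (if j = 0 then [] else
    ((List.finRange Q.D).flatMap fun i => (List.range (Q.L + 1)).map (Task.bs i)) ++
    ((List.range (Q.D + 1)).flatMap fun sc =>
      ((List.range (Q.D + 1)).flatMap fun m =>
        Task.ex sc m :: (List.range Q.Wf).map (Task.pf sc m)) ++ [Task.st sc]) ++
    (List.range Q.Wa).map Task.ap) ++
  ((List.finRange Q.D).flatMap fun i => [Task.eqGe i, Task.eqLe i]) ++
  (List.finRange Q.D).map Task.fa ++ [Task.close]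

/-- The location schedule: levels `0, …, D` (the final query `Task.fin` is asked afterwards by the
machine). [cite: FournierKoiran2000, §2.1, Thm 3] -/
def agenda : List (Task Q.D) :=
  (List.range (Q.D + 1)).flatMap (levelTasks Q)

/-! ### State -/

/-- The record of a completed level: centre numerators, stable scale, apex `(σ, d)`, exit facet.
[cite: FournierKoiran2000, §2.1 (`c_n^k`, `s_n^k`, `i_k`, `ε_k`)] -/
structure LevelRec (D : ℕ) : Type where
  /-- numerators of the centre over `2^{L+1}` -/
  m : Fin D → ℤ
  /-- the stable scale -/
  sc : ℕ
  /-- the apex: numerators and denominator -/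
  apex : (Fin D → ℤ) × ℕ
  /-- exit coordinate -/
  istar : Fin D
  /-- exit sign -/
  εstar : ℤ

/-- The default record (used to pad `certOf` beyond the depth). [folklore] -/
def LevelRec.dflt : LevelRec Q.D := ⟨0, 0, (0, 1), ⟨0, Q.D_pos⟩, 1⟩

/-- The scratch data of the level in progress. [folklore] -/
@[ext] structure Scratch (D : ℕ) : Type where
  /-- centre numerators found so far -/
  m : Fin D → ℤ
  /-- running binary-search numerator -/
  bsAcc : ℕ
  /-- chain of the scale in progress -/
  chain : List (Fin D → ℤ)
  /-- did the existence query of the current slot say yes? -/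
  exOk : Bool
  /-- prefix bits in progress -/
  bits : List Bool
  /-- the first stable scale and its chain, once found -/
  stable : Option (ℕ × List (Fin D → ℤ))
  /-- the apex (level `0`: the origin `(0, 1)`) -/
  apex : (Fin D → ℤ) × ℕ
  /-- answers to `x_i - s_i ≥ 0`? -/
  ge : Fin D → Bool
  /-- answers to `s_i - x_i ≥ 0`? -/
  le : Fin D → Bool
  /-- facet candidate -/
  cand : Option (Fin D)

/-- Fresh scratch data. [folklore] -/
def Scratch.init (D : ℕ) : Scratch D := ⟨0, 0, [], false, [], none, (0, 1), fun _ => false, fun _ => false, none⟩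

/-- The state of the protocol: bottom reached?, output bit, current chart, completed levels (most
recent first), scratch. [cite: FournierKoiran2000, §2.1] -/
@[ext] structure Data (D : ℕ) : Type where
  /-- the bottom (`x^{(J)} = s_J`) has been reached -/
  done : Bool
  /-- the answer to the final query -/
  out : Bool
  /-- the current chart -/
  chart : Fin D → ℤ
  /-- completed levels, most recent first -/
  levels : List (LevelRec D)
  /-- scratch of the level in progress -/
  cur : Scratch D

/-- The initial state. [folklore] -/
def Data.init (D : ℕ) : Data D := ⟨false, false, 0, [], Scratch.init D⟩

variable {Q}

/-- The level context of a state (chart, numerators of earlier apexes, centre numerators).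
[cite: FournierKoiran2000, §2.1] -/
def Data.ctx (dat : Data Q.D) : LevelCtx Q := ⟨dat.chart, dat.levels.map fun r => r.apex.1, dat.cur.m⟩

/-- The apex records of the completed levels, most recent first (the argument of `liftAll`).
[cite: FournierKoiran2000, §2.1 Step k] -/
def Data.hist (dat : Data Q.D) : List (ApexRec Q.D) :=
  dat.levels.map fun r => ⟨r.apex.1, r.apex.2, r.istar, r.εstar⟩

/-! ### Forms of the sign tasks -/

section Forms

variable {D : ℕ}

/-- Binary search test of coordinate `i`, round `k`, current numerator `acc`:
`2^k y_i + 2^k - 2 acc - 1 ≥ 0 ⟺ y_i ≥ -1 + (2 acc + 1) 2^{-k}`. [cite: FournierKoiran2000, §2.1 Step 1] -/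
def bsForm (i : Fin D) (k acc : ℕ) : AffForm D :=
  (fun i' => if i' = i then 2 ^ k else 0, 2 ^ k - 2 * acc - 1)

/-- Test `y_i - s_i ≥ 0` for `s = σ/d`: `d y_i - σ_i ≥ 0`. [cite: FournierKoiran2000, §2.1 (the test `x = s_n^1`)] -/
def geForm (apex : (Fin D → ℤ) × ℕ) (i : Fin D) : AffForm D :=
  (fun i' => if i' = i then (apex.2 : ℤ) else 0, -apex.1 i)

/-- Test `s_i - y_i ≥ 0`. [cite: FournierKoiran2000, §2.1] -/
def leForm (apex : (Fin D → ℤ) × ℕ) (i : Fin D) : AffForm D :=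
  (fun i' => if i' = i then -(apex.2 : ℤ) else 0, apex.1 i)

/-- The sign `sgn (y_i - s_i) ∈ {-1, 0, 1}` read off the two equality-test answers. [folklore] -/
def signOf (ge le : Bool) : ℤ := if ge then (if le then 0 else 1) else -1

/-- Facet comparison "hitting parameter of `c` ≤ hitting parameter of `i`?" for `s = σ/d` and signs
`ε_c, ε_i` of the directions: `ν_i |d_c| - ν_c |d_i| ≥ 0` cleared of denominators
(`ν_k = 1 - ε_k s_k`, `|d_k| = ε_k (y_k - s_k)`). [cite: FournierKoiran2000, §2.1 (determining the face `f_n^k` of the cube hit by the ray)] -/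
def faForm (apex : (Fin D → ℤ) × ℕ) (εc εi : ℤ) (c i : Fin D) : AffForm D :=
  let d : ℤ := apex.2
  let νc : ℤ := d - εc * apex.1 c
  let νi : ℤ := d - εi * apex.1 i
  (fun i' => (if i' = c then νi * εc * d else 0) + (if i' = i then -(νc * εi * d) else 0),
    -(νi * εc * apex.1 c) + νc * εi * apex.1 i)

end Forms

/-- A coordinate is a VALID facet candidate: free and moving. [folklore] -/
def Data.validB (dat : Data Q.D) (i : Fin Q.D) : Bool :=
  decide (dat.chart i = 0) && decide (signOf (dat.cur.ge i) (dat.cur.le i) ≠ 0)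

/-- The level-local form of a sign task (junk `(0,0)` for NP tasks and idle facet rounds).
[cite: FournierKoiran2000, §2.1] -/
def localForm (dat : Data Q.D) : Task Q.D → AffForm Q.D
  | Task.bs i k => bsForm i k (if k = 0 then 0 else dat.cur.bsAcc)
  | Task.eqGe i => geForm dat.cur.apex i
  | Task.eqLe i => leForm dat.cur.apex i
  | Task.fa i =>
    match dat.cur.cand with
    | none => (0, 0)
    | some c => faForm dat.cur.apex (signOf (dat.cur.ge c) (dat.cur.le c)) (signOf (dat.cur.ge i) (dat.cur.le i)) c i
  | _ => (0, 0)

/-- **The form actually queried**: the local form lifted through the apexes of the completed levels.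
[cite: FournierKoiran2000, §2.1 Step k ("a test `h'` on `x^k` is done by performing the test `Aff(s_n^1, Aff(s_n^2, …))` on `x`")] -/
def queryForm (dat : Data Q.D) (τ : Task Q.D) : AffForm Q.D := liftAll dat.hist (localForm dat τ)

/-! ### Statements of the NP tasks -/

/-- Stability test with an explicit chain (`LevelCtx.Unstable choose sc` is the case of the built
chain). [cite: FournierKoiran2000, §2.1] -/
def LevelCtx.UnstableCh (Λ : LevelCtx Q) (ch : List (Fin Q.D → ℤ)) (sc : ℕ) : Prop :=
  ∃ a ∈ Λ.F (sc + 1), ∃ z, SmallPt (Q := Q) z ∧ z ∈ Λ.E ch ∧ lin a z ≠ 0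

/-- `Unstable` is `UnstableCh` at the built chain. [folklore] -/
theorem LevelCtx.unstable_iff (Λ : LevelCtx Q) (choose : ℕ → List (Fin Q.D → ℤ) → (Fin Q.D → ℤ)) (sc : ℕ) :
    Λ.Unstable choose sc ↔ Λ.UnstableCh (Λ.chainOf choose sc) sc :=
  Iff.rfl

/-- **The statement asked by an NP task** in a given state (`finT`: the final question, a property
of the located certificate). [cite: FournierKoiran2000, §2.1 (the conditions checked "with a boolean NP algorithm"), Thm 3] -/
def npTruth (finT : Cert Q.D → Prop) (Γof : Data Q.D → Cert Q.D) (dat : Data Q.D) : Task Q.D → Prop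
  | Task.ex sc _ => ∃ a z z', dat.ctx.ValidTriple sc dat.cur.chain a z z'
  | Task.pf sc _ _ => ∃ w, dat.ctx.FormP sc dat.cur.chain w ∧ w.length = Q.Wf ∧ dat.cur.bits ++ [true] <+: w
  | Task.st sc => dat.ctx.UnstableCh dat.cur.chain sc
  | Task.ap _ =>
    let p := dat.cur.stable.getD (0, [])
    ∃ w, dat.ctx.ApexP p.1 p.2 w ∧ w.length = Q.Wa ∧ dat.cur.bits ++ [true] <+: w
  | Task.fin => finT (Γof dat)
  | _ => False

open Classical in
/-- **The truthful answer** to a task in a state, for the input `x̂`: sign of the queried form at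
`x̂`, or truth of the NP statement. [cite: FournierKoiran2000, §2.1] -/
noncomputable def truth (finT : Cert Q.D → Prop) (Γof : Data Q.D → Cert Q.D) (xh : Fin Q.D → ℝ)
    (dat : Data Q.D) (τ : Task Q.D) : Bool :=
  if τ.isSign then decide (0 ≤ aff (queryForm dat τ) xh) else decide (npTruth finT Γof dat τ)

/-! ### The transition -/

variable (Q)

/-- The record of the level being closed, with the given exit data. [folklore] -/
def closeRec (c : Scratch Q.D) (istar : Fin Q.D) (ε : ℤ) : LevelRec Q.D :=
  ⟨c.m, (c.stable.map Prod.fst).getD 0, c.apex, istar, ε⟩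

/-- Closing a level (task `close`) after the facet phase: bottom (no moving coordinate: `x^{(j)} = s_j`) or a new
level record and chart. [cite: FournierKoiran2000, §2.1 ("If `x = s_n^1` we accept … Otherwise we repeat the same procedure in dimension `n-1`")] -/
def finishLevel (dat : Data Q.D) : Data Q.D :=
  match dat.cur.cand with
  | none =>
    { dat with done := true, levels := closeRec Q dat.cur ⟨0, Q.D_pos⟩ 1 :: dat.levels, cur := Scratch.init Q.D }
  | some c =>
    { dat with chart := Function.update dat.chart c (if dat.cur.ge c then 1 else -1),
               levels := closeRec Q dat.cur c (if dat.cur.ge c then 1 else -1) :: dat.levels,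
               cur := Scratch.init Q.D }

/-- **The state transition** on the answer bit `b` to the task `τ`. [cite: FournierKoiran2000, §2.1 Steps 1 and k] -/
def upd (dat : Data Q.D) (τ : Task Q.D) (b : Bool) : Data Q.D :=
  if dat.done then dat else
  match τ with
  | Task.bs i k =>
    if dat.chart i ≠ 0 then
      (if k = Q.L then
        { dat with cur := { dat.cur with m := Function.update dat.cur.m i (dat.chart i * 2 ^ (Q.L + 1)), bsAcc := 0 } }
       else dat)
    else
      let acc := if k = 0 then 0 else dat.cur.bsAcc
      let acc' := 2 * acc + b.toNat
      if k = Q.L then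
        { dat with cur := { dat.cur with m := Function.update dat.cur.m i (2 * (acc' : ℤ) + 1 - 2 ^ (Q.L + 1)), bsAcc := 0 } }
      else { dat with cur := { dat.cur with bsAcc := acc' } }
  | Task.ex _ _ => { dat with cur := { dat.cur with exOk := b, bits := [] } }
  | Task.pf _ _ w =>
    if dat.cur.exOk then
      let bits' := dat.cur.bits ++ [b]
      if w + 1 = Q.Wf then
        { dat with cur := { dat.cur with chain := dat.cur.chain ++ [decodeForm Q.bB Q.D bits'], bits := [], exOk := false } }
      else { dat with cur := { dat.cur with bits := bits' } }
    else dat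
  | Task.st sc =>
    { dat with cur := { dat.cur with
        stable := (match dat.cur.stable with
          | some p => some p
          | none => if b then none else some (sc, dat.cur.chain)),
        chain := [], bits := [], exOk := false } }
  | Task.ap w =>
    let bits' := dat.cur.bits ++ [b]
    if w + 1 = Q.Wa then
      { dat with cur := { dat.cur with apex := decodeApex Q.W Q.D bits', bits := [] } }
    else { dat with cur := { dat.cur with bits := bits' } }
  | Task.eqGe i => { dat with cur := { dat.cur with ge := Function.update dat.cur.ge i b } }
  | Task.eqLe i => { dat with cur := { dat.cur with le := Function.update dat.cur.le i b } }
  | Task.fa i =>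
    let v := dat.validB i
    let cand' : Option (Fin Q.D) := match dat.cur.cand with
      | none => if v then some i else none
      | some c => if v && !b then some i else some c
    { dat with cur := { dat.cur with cand := cand' } }
  | Task.close => finishLevel Q dat
  | Task.fin => { dat with out := b }

/-! ### The certificate read off the state -/

/-- The completed levels, oldest first. [folklore] -/
def Data.levelsOld (dat : Data Q.D) : List (LevelRec Q.D) := dat.levels.reverse

/-- The record of level `j` (default beyond the recorded ones). [folklore] -/
def Data.recAt (dat : Data Q.D) (j : ℕ) : LevelRec Q.D := ((Data.levelsOld Q dat)[j]?).getD (LevelRec.dflt Q)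

/-- **The location certificate of a state.** [cite: FournierKoiran2000, §2.1 (the data of all steps)] -/
def certOf (dat : Data Q.D) : Cert Q.D where
  J := dat.levels.length - 1
  p j := fun i => ((Data.recAt Q dat j).m i : ℚ) / 2 ^ (Q.L + 1)
  ρ j := Q.ρ ((Data.recAt Q dat j).sc + 1)
  s j := fun i => ((Data.recAt Q dat j).apex.1 i : ℚ) / (Data.recAt Q dat j).apex.2
  istar j := (Data.recAt Q dat j).istar
  εstar j := (Data.recAt Q dat j).εstar

/-! ### Runs -/

/-- One step with the truthful answer. [folklore] -/
noncomputable def step (finT : Cert Q.D → Prop) (xh : Fin Q.D → ℝ) (dat : Data Q.D) (τ : Task Q.D) : Data Q.D :=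
  upd Q dat τ (truth finT (certOf Q) xh dat τ)

/-- Running a list of tasks with truthful answers. [folklore] -/
noncomputable def runFrom (finT : Cert Q.D → Prop) (xh : Fin Q.D → ℝ) (dat : Data Q.D) (ts : List (Task Q.D)) :
    Data Q.D :=
  ts.foldl (step Q finT xh) dat

/-- **The final state** of the location protocol on `x̂` with truthful answers. [cite: FournierKoiran2000, Thm 2] -/
noncomputable def finalData (finT : Cert Q.D → Prop) (xh : Fin Q.D → ℝ) : Data Q.D :=
  runFrom Q finT xh (Data.init Q.D) (agenda Q)

/-- `runFrom` over a concatenation. [folklore] -/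
theorem runFrom_append (finT : Cert Q.D → Prop) (xh : Fin Q.D → ℝ) (dat : Data Q.D) (ts ts' : List (Task Q.D)) :
    runFrom Q finT xh dat (ts ++ ts') = runFrom Q finT xh (runFrom Q finT xh dat ts) ts' :=
  List.foldl_append

/-- `runFrom` on a cons. [folklore] -/
theorem runFrom_cons (finT : Cert Q.D → Prop) (xh : Fin Q.D → ℝ) (dat : Data Q.D) (τ : Task Q.D) (ts : List (Task Q.D)) :
    runFrom Q finT xh dat (τ :: ts) = runFrom Q finT xh (step Q finT xh dat τ) ts :=
  rfl

/-- `runFrom` on the empty list. [folklore] -/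
@[simp] theorem runFrom_nil (finT : Cert Q.D → Prop) (xh : Fin Q.D → ℝ) (dat : Data Q.D) :
    runFrom Q finT xh dat [] = dat :=
  rfl

end FKPointLocation

end Literature.Computability.Complexity
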